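import Summits.ResolutionOfSingularities.ResolutionOfSingularities.Theorems.WeightedInvariantKeyRungThreeOfResidue
import HarnessLib

/-!
# The dominance word `TwoFlagDominanceAtLevelLE3Body p` from its residue AT THE POWER POSITIONS ONLY
# (door `HypersurfaceCentreConstruction`, stmt-ResolutionOfSingularities-19897; P3 rung for the named pair `(ι₃ᵗ, J₃ᵗ)`)

Topic: `Summits/ResolutionOfSingularities/ResolutionOfSingularities/Theorems`. Helper for the door item `HypersurfaceCentreConstruction`
(stmt-ResolutionOfSingularities-19897, route `WeightedInvariant`), line `local-engine`, def-free.  Sharpening of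
`twoFlagDominanceAtLevelLE3Body_of_residue` (…Iota3DominanceWordResidue) by `Iota3.twoFlagDominanceAtLevelAt_of_not_power`
(…KeyRungThreeOfResidue): the residue (second-member dominance at the triples `q < r₂ < r₁`) is only needed at the LE3 positions whose tangent
form IS a `ν`-th power of a linear form — `f ∈ (ℓ^ν) + 𝔪^{ν+1}` for some `ℓ ∈ 𝔪`, `ν = ord f` — since at every other position the word holds
outright.  `twoFlagDominanceAtLevelLE3Body_of_residue_at_powers`; and the P3 rung for the named pair modulo the five clause words and THIS
sharper residue, `keyRungGrHomLE_three_of_residue_at_powers`.  RE-ENTRY OBJECT #1 of chain w43, final form after this hand.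
[OURS · L1 W4.3 · (o70-b)/(Δ12); candidates stay candidates; nothing here is a statement of H. Hironaka's 2017 manuscript; AI-written, weaker than
expert review; no claim about resolution of singularities in characteristic `p` beyond the typed statements.]  No definition; no axiom.
-/

noncomputable section

set_option linter.dupNamespace false -- mandated namespace of this single-conjunct summit

open IsLocalRing Literature.AlgebraicGeometry.Resolution
open Summit.ResolutionOfSingularities.ResolutionOfSingularities.Theorems

namespace Summit.ResolutionOfSingularities.ResolutionOfSingularities.Cruxes.HypersurfaceCentreConstruction.LocalEngine

/-- **`TwoFlagDominanceAtLevelLE3Body p` FROM ITS RESIDUE AT THE POWER POSITIONS**: second-member dominance at the triples `q < r₂ < r₁`, required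
only at the LE3 point-centre positions with `f ∈ (ℓ^ν) + 𝔪^{ν+1}` for some `ℓ ∈ 𝔪` (`ν = ord f`). [OURS · L1 W4.3 · (o70-b)/(Δ12)] -/
theorem twoFlagDominanceAtLevelLE3Body_of_residue_at_powers (p : ℕ)
    (hres : ∀ (k₀ : Type) [Field k₀] [CharP k₀ p] [PerfectField k₀]
      (S : Type) [CommRing S] [Algebra k₀ S] [Algebra.EssFiniteType k₀ S] [IsRegularLocalRing S] (f : S),
      ringKrullDim S = (3 : ℕ) → f ≠ 0 → f ∈ (maximalIdeal S) ^ 2 →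
      ContactCylinder.topStratumPrime Iota3.iotaOrdEpsTau S f = maximalIdeal S → Iota3.iotaEps S f ≠ 1 →
      (∃ ℓ ∈ maximalIdeal S, f ∈ Ideal.span {ℓ ^ (adicOrder f).toNat} ⊔ maximalIdeal S ^ ((adicOrder f).toNat + 1)) →
      ∀ (a b : ℕ), 0 < b →
      (∀ q' r₁' r₂' : ℕ, Iota3.AdmissibleTriple q' r₁' r₂' → Iota3.FlagReaches f (adicOrder f).toNat q' r₁' r₂' →
        r₁' * b ≤ a * r₂') →
      ∀ (g₁ g₂ g₁' g₂' : S) (q r₁ r₂ : ℕ), Iota3.AdmissibleTriple q r₁ r₂ → r₁ * b = a * r₂ → q < r₂ → r₂ < r₁ →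
        Iota3.IsTwoFlag g₁ g₂ → Iota3.IsTwoFlag g₁' g₂' →
        f ∈ Iota3.flagContactFiltration g₁ g₂ q r₁ r₂ (r₁ * (adicOrder f).toNat) →
        f ∈ Iota3.flagContactFiltration g₁' g₂' q r₁ r₂ (r₁ * (adicOrder f).toNat) →
        g₂' ∈ Iota3.flagContactFiltration g₁ g₂ q r₁ r₂ r₂) :
    TwoFlagDominanceAtLevelLE3Body p := by
  intro k₀ _ _ _ S _ _ _ _ f hdim hf0 hf2 htop hε
  have hfm : f ∈ maximalIdeal S := Ideal.pow_le_self two_ne_zero hf2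
  by_cases hpow : ∃ ℓ ∈ maximalIdeal S, f ∈ Ideal.span {ℓ ^ (adicOrder f).toNat} ⊔ maximalIdeal S ^ ((adicOrder f).toNat + 1)
  · exact Iota3.twoFlagDominanceAtLevelAt_of_residue hdim hf0 hfm (hres k₀ S f hdim hf0 hf2 htop hε hpow)
  · refine Iota3.twoFlagDominanceAtLevelAt_of_not_power hdim hf0 hfm fun ℓ hℓ hmem => hpow ⟨ℓ, hℓ, hmem⟩

/-- **P3 RUNG FOR THE NAMED PAIR MODULO FIVE CLAUSE WORDS AND THE RESIDUE AT THE POWER POSITIONS** (`keyRungGrHomLE_three_of_dominance` ∘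
`twoFlagDominanceAtLevelLE3Body_of_residue_at_powers`).  The hypothesis list is the gap list of the registered stub `stub_keyRungGrHomLE_three`
after this hand. [OURS · audit glue] -/
theorem keyRungGrHomLE_three_of_residue_at_powers (p : ℕ)
    (hc8 : IotaUpperSemicontinuousLE 3 p Iota3.iotaFlatT)
    (hc10 : IotaTorusFactorMonotoneLE 3 p Iota3.iotaFlatT)
    (hc11 : IotaJEssSmoothCompatibleLE 3 Iota3.iotaFlatT Iota3.jFlatT)
    (hgame : CanonicalGameClauseHomLE 3 p Iota3.iotaFlatT Iota3.jFlatT)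
    (hres : ∀ (k₀ : Type) [Field k₀] [CharP k₀ p] [PerfectField k₀]
      (S : Type) [CommRing S] [Algebra k₀ S] [Algebra.EssFiniteType k₀ S] [IsRegularLocalRing S] (f : S),
      ringKrullDim S = (3 : ℕ) → f ≠ 0 → f ∈ (maximalIdeal S) ^ 2 →
      ContactCylinder.topStratumPrime Iota3.iotaOrdEpsTau S f = maximalIdeal S → Iota3.iotaEps S f ≠ 1 →
      (∃ ℓ ∈ maximalIdeal S, f ∈ Ideal.span {ℓ ^ (adicOrder f).toNat} ⊔ maximalIdeal S ^ ((adicOrder f).toNat + 1)) →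
      ∀ (a b : ℕ), 0 < b →
      (∀ q' r₁' r₂' : ℕ, Iota3.AdmissibleTriple q' r₁' r₂' → Iota3.FlagReaches f (adicOrder f).toNat q' r₁' r₂' →
        r₁' * b ≤ a * r₂') →
      ∀ (g₁ g₂ g₁' g₂' : S) (q r₁ r₂ : ℕ), Iota3.AdmissibleTriple q r₁ r₂ → r₁ * b = a * r₂ → q < r₂ → r₂ < r₁ →
        Iota3.IsTwoFlag g₁ g₂ → Iota3.IsTwoFlag g₁' g₂' →
        f ∈ Iota3.flagContactFiltration g₁ g₂ q r₁ r₂ (r₁ * (adicOrder f).toNat) →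
        f ∈ Iota3.flagContactFiltration g₁' g₂' q r₁ r₂ (r₁ * (adicOrder f).toNat) →
        g₂' ∈ Iota3.flagContactFiltration g₁ g₂ q r₁ r₂ r₂)
    (hgr : IotaUpperSemicontinuousGradedLE 3 p Iota3.iotaFlatT) :
    KeyRungGrHomLE 3 p :=
  keyRungGrHomLE_three_of_dominance p hc8 hc10 hc11 hgame (twoFlagDominanceAtLevelLE3Body_of_residue_at_powers p hres) hgr

end Summit.ResolutionOfSingularities.ResolutionOfSingularities.Cruxes.HypersurfaceCentreConstruction.LocalEngine

end
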